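import Summits.HodgeConjecture.CorCM.ReflexFieldsMeetRealCMHodge
import Summits.HodgeConjecture.CorCM.QuadraticSubfieldFibres
import Summits.HodgeConjecture.CorCM.GaloisSexticThreefoldPairsHodge
import Literature.NumberTheory.ComplexMultiplication.CMTypeCount
import HarnessLib

/-!
# Two simple CM abelian THREEFOLDS whose sextic CM fields contain NON-ISOMORPHIC imaginary quadratic fields:
# `Hg(T₀ × T₁) = Hg(T₀) × Hg(T₁)` and the Hodge conjecture on every `T₀^a × T₁^b`

COR-CM (cell `pub-hodgecm2`, binder seat `b16` gen 42, count-neutral claim CM33-QUADDISTINCT, file F3; theorems only, no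
definition, no named fact, no `sorry`).  NEW as stated, hence under `Summits/`.  The two cases of the census of pairs of
simple CM abelian threefolds left open by this seat's card `CM33-PAIRFLIP` (gen 41): sextic CM fields `K₀ ⊇ k₀`,
`K₁ ⊇ k₁` through imaginary quadratic fields (Galois closures cyclic `C₆` or dihedral `D₆ = 𝔖₃ × C₂`, i.e. `K = K⁺·k`
with `K⁺` a totally real cubic) with `k₀ ≄ k₁` — including the TWINS `K⁺(√−m)`, `K⁺(√−m·disc K⁺)` inside one Galois
field of degree `12`, invisible to every criterion on Galois closures.

* §1 `WeilFibre.exists_mem_forall_smul_eq` — for a sextic CM field `L ⊇ k` (`k` imaginary quadratic) and a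
  NONDEGENERATE type `Θ`, the LONELY member `φ* ∈ Θ` (the unique member over the embedding `ψ` of `k` with
  `n(ψ) = 1`, `WeilFibre.exists_card_fibre_mem_eq_one`) satisfies `Stab(φ*) ⊆ Stab(Θ)` in `Aut(ℂ)`: `Θ = {φ*} ∪
  (fibre(ψ̄) ∖ {φ̄*})`, and an automorphism fixing `φ*` fixes `ψ`, `ψ̄`, `φ̄*` and permutes the fibres
  (the reflex field of `(L, Θ)` is `φ*(L)`);
* §2 `WeilFibre.nonempty_algEquiv_of_finrank_eq_two` — a field of degree not divisible by `4` has at most one quadratic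
  subfield (the compositum of two would have degree `4`); **`WeilFibre.conj_apply_eq_of_mem_fieldRange`** — for
  sextic CM `K₀ ⊇ k₀`, `K₁ ⊇ k₁` with `Hom(k₀, k₁) = ∅` and ANY embeddings `φ₀`, `φ₁`: complex conjugation fixes
  `φ₀(K₀) ∩ φ₁(K₁)` pointwise (that conjugation-stable field has even degree dividing `6` unless real — Artin — and
  degree `2` or `6` would put one imaginary quadratic field in both `K₀` and `K₁`);
* §3 hence, by `CorCM/ReflexFieldsMeetRealCMHodge` (fields of definition meeting in a real field):
  **`isNondegenerateFamily_iff_forall_of_isEmpty_quadratic_ringHom`** (the pair is nondegenerate iff its members are),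
  **`isNondegenerateFamily_sexticThreefolds_of_isEmpty_quadratic_ringHom`** (simple threefolds: always),
  **`hodgeConjectureFor_prod_sexticThreefolds_of_isEmpty_quadratic_ringHom`** (the Hodge conjecture and `B• = D•` on
  every `⨁_{j<N} T_{π j}`, UNCONDITIONALLY), `not_exists_exceptional_prod_sexticThreefolds_of_isEmpty_quadratic_ringHom`.

The census of ALL pairs of simple CM threefolds is assembled in `CorCM/SimpleCMThreefoldPairsHodge`.  HC_CM is NOT
touched; wording of record untouched.

## References

* [Gordon1999HodgeAVSurvey] B. B. Gordon, *A survey of the Hodge conjecture for abelian varieties*, §3 Theorem, 7.5–7.7,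
  10.10; Ribet's bound (3.7).
* [Shimura1998] G. Shimura, *Abelian Varieties with Complex Multiplication and Modular Functions*, §8.3, §8.4, §18.1.
* [MoonenZarhin1999LowDim] B. Moonen, Yu. Zarhin, Math. Ann. 315 (1999), (1.9) (multiplicities `(2,1)`).
* [Lang2002] S. Lang, *Algebra*, 3rd ed., VI §1 Thm. 1.1, Thm. 1.8 (Artin), Cor. 1.6.
-/

noncomputable section

open NumberField NumberField.ComplexEmbedding Module

namespace Summit.HodgeConjecture.CorCM

open Literature.NumberTheory.ComplexMultiplication
open Literature.AlgebraicGeometry.Motives (AbelianVariety CMType)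
open Literature.AlgebraicGeometry.Pohlmann1968

namespace WeilFibre

/-! ## §1 One sextic field `L ⊇ k`: the lonely member of a nondegenerate type and its stabiliser -/

section Lonely

variable {k L : Type} [Field k] [NumberField k] [IsTotallyComplex k] [Field L] [NumberField L] [IsCMField L]

/-- For an imaginary quadratic `k`, an automorphism of `ℂ` fixing `ψ : k → ℂ` fixes `ψ̄` (`Aut(ℂ)` commutes with
conjugation on the embeddings of a CM field). [cite: Shimura1998, §18.1] -/
theorem smul_conjugate_eq_of_smul_eq (h2 : finrank ℚ k = 2) {σ : ℂ ≃+* ℂ} {ψ : k →+* ℂ} (hσ : σ • ψ = ψ) :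
    σ • conjugate ψ = conjugate ψ := by
  haveI := CMTypeCount.isCMField_of_finrank_eq_two (K := k) h2
  rw [← conj_smul_eq_conjugate, (isCMTypeWith_conj (CMTypeCount.stdCMType (K := k))).comm σ ψ, hσ]

omit [NumberField k] [IsTotallyComplex k] [NumberField L] [IsCMField L] in
/-- Restriction along `e : k → L` commutes with the action: `(σ ∘ s) ∘ e = σ ∘ (s ∘ e)`. [folklore] -/
theorem smul_comp (σ : ℂ ≃+* ℂ) (s : L →+* ℂ) (e : k →+* L) : (σ • s).comp e = σ • s.comp e := rfl

open scoped Classical in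
/-- **The lonely member.**  For a sextic CM field `L ⊇ k` (`k` imaginary quadratic) and a NONDEGENERATE CM type `Θ` of
`L` there are an embedding `ψ` of `k` and a member `φ* ∈ Θ` over `ψ` such that `φ*` is the ONLY member of `Θ` over `ψ`
(multiplicities `(1, 2)` of `k` on the tangent space). [cite: MoonenZarhin1999LowDim, (1.9)] [cite: Shimura1998, §18.1] -/
theorem exists_mem_unique_fibre (h2 : finrank ℚ k = 2) (h6 : finrank ℚ L = 6) (e : k →+* L) {Θ : CMType L}
    (hnd : IsNondegenerate Θ) :
    ∃ (ψ : k →+* ℂ) (φ : L →+* ℂ), φ ∈ Θ.1 ∧ φ.comp e = ψ ∧ ∀ s : L →+* ℂ, s.comp e = ψ → s ∈ Θ.1 → s = φ := by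
  obtain ⟨ψ₀⟩ : Nonempty (k →+* ℂ) := inferInstance
  obtain ⟨ψ, -, hψ⟩ := exists_card_fibre_mem_eq_one (CMTypeCount.stdCMType (K := k)) h2 h6 e hnd ψ₀
  obtain ⟨φ, hφ⟩ := Finset.card_eq_one.1 hψ
  have hmem : φ ∈ Finset.univ.filter fun s : L →+* ℂ => s.comp e = ψ ∧ s ∈ Θ.1 := by
    rw [hφ]; exact Finset.mem_singleton_self φ
  simp only [Finset.mem_filter, Finset.mem_univ, true_and] at hmem
  refine ⟨ψ, φ, hmem.2, hmem.1, fun s hs hsΘ => ?_⟩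
  have : s ∈ Finset.univ.filter fun s : L →+* ℂ => s.comp e = ψ ∧ s ∈ Θ.1 :=
    Finset.mem_filter.2 ⟨Finset.mem_univ s, hs, hsΘ⟩
  rw [hφ] at this
  exact Finset.mem_singleton.1 this

omit [NumberField L] [IsCMField L] in
/-- **Membership in `Θ` read off the lonely member**: with `ψ`, `φ*` as in `exists_mem_unique_fibre`,
`s ∈ Θ ⟺ s = φ* ∨ (s ∘ e = ψ̄ ∧ s ≠ φ̄*)` — `Θ` is `φ*` together with the fibre of `ψ̄` minus `φ̄*`.
[cite: Shimura1998, §18.1] -/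
theorem mem_iff_of_unique_fibre (h2 : finrank ℚ k = 2) (e : k →+* L) {Θ : CMType L} {ψ : k →+* ℂ} {φ : L →+* ℂ}
    (hφ : φ ∈ Θ.1) (hφψ : φ.comp e = ψ) (huniq : ∀ s : L →+* ℂ, s.comp e = ψ → s ∈ Θ.1 → s = φ) (s : L →+* ℂ) :
    s ∈ Θ.1 ↔ s = φ ∨ (s.comp e = conjugate ψ ∧ s ≠ conjugate φ) := by
  constructor
  · intro hs
    rcases comp_eq_or_eq_conjugate (CMTypeCount.stdCMType (K := k)) h2 e ψ s with h | h
    · exact Or.inl (huniq s h hs)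
    · refine Or.inr ⟨h, fun hbar => ?_⟩
      rw [hbar] at hs
      exact (Θ.2 φ).1 hφ hs
  · rintro (rfl | ⟨hs, hne⟩)
    · exact hφ
    · by_contra hsΘ
      -- then `s̄ ∈ Θ` lies over `ψ`, so `s̄ = φ` and `s = φ̄`
      have hbar : conjugate s ∈ Θ.1 := by
        by_contra h
        exact hsΘ ((Θ.2 s).2 h)
      have hbare : (conjugate s).comp e = ψ := by
        rw [conjugate_comp, hs]
        exact ComplexEmbedding.involutive_conjugate k ψ
      have := huniq _ hbare hbar
      exact hne (by rw [← this]; exact (ComplexEmbedding.involutive_conjugate L s).symm)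

/-- **The stabiliser of the lonely member stabilises the type** (`Aut(ℂ/φ*(L)) ⊆ Stab Θ`: the reflex field of a
primitive sextic type over `k` is the image of its lonely member).  With `ψ`, `φ*` as in `exists_mem_unique_fibre`:
if `σ ∈ Aut(ℂ)` fixes `φ*` then `σΘ = Θ`. [cite: Shimura1998, §8.4 and §18.1] -/
theorem forall_smul_mem_iff_of_unique_fibre (h2 : finrank ℚ k = 2) (e : k →+* L) {Θ : CMType L} {ψ : k →+* ℂ}
    {φ : L →+* ℂ} (hφ : φ ∈ Θ.1) (hφψ : φ.comp e = ψ)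
    (huniq : ∀ s : L →+* ℂ, s.comp e = ψ → s ∈ Θ.1 → s = φ) {σ : ℂ ≃+* ℂ} (hσ : σ • φ = φ) (x : L →+* ℂ) :
    σ • x ∈ Θ.1 ↔ x ∈ Θ.1 := by
  -- `σ` fixes `ψ = φ ∘ e`, hence `ψ̄`, hence the restriction of every `x` (which is `ψ` or `ψ̄`), and fixes `φ̄`
  have hσψ : σ • ψ = ψ := by rw [← hφψ, ← smul_comp, hσ]
  have hσψ' : σ • conjugate ψ = conjugate ψ := smul_conjugate_eq_of_smul_eq h2 hσψ
  have hres : (σ • x).comp e = x.comp e := by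
    rw [smul_comp]
    rcases comp_eq_or_eq_conjugate (CMTypeCount.stdCMType (K := k)) h2 e ψ x with h | h
    · rw [h, hσψ]
    · rw [h, hσψ']
  have hσφ' : σ • conjugate φ = conjugate φ := by
    rw [← conj_smul_eq_conjugate, (isCMTypeWith_conj Θ).comm σ φ, hσ]
  have hinj : ∀ y z : L →+* ℂ, σ • y = σ • z → y = z := fun y z h => smul_left_cancel σ h
  rw [mem_iff_of_unique_fibre h2 e hφ hφψ huniq, mem_iff_of_unique_fibre h2 e hφ hφψ huniq, hres]
  refine or_congr ⟨fun h => hinj _ _ (h.trans hσ.symm), fun h => by rw [h, hσ]⟩ (and_congr Iff.rfl ?_)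
  exact not_congr ⟨fun h => hinj _ _ (h.trans hσφ'.symm), fun h => by rw [h, hσφ']⟩

/-- **Packaged**: a nondegenerate type of a sextic CM field `L ⊇ k` has a member `φ*` whose stabiliser in `Aut(ℂ)`
stabilises the type. [cite: Shimura1998, §8.4 and §18.1] [cite: MoonenZarhin1999LowDim, (1.9)] -/
theorem exists_mem_forall_smul_eq (h2 : finrank ℚ k = 2) (h6 : finrank ℚ L = 6) (e : k →+* L) {Θ : CMType L}
    (hnd : IsNondegenerate Θ) :
    ∃ φ : L →+* ℂ, φ ∈ Θ.1 ∧ ∀ σ : ℂ ≃+* ℂ, σ • φ = φ → ∀ x : L →+* ℂ, σ • x ∈ Θ.1 ↔ x ∈ Θ.1 := by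
  obtain ⟨ψ, φ, hφ, hφψ, huniq⟩ := exists_mem_unique_fibre h2 h6 e hnd
  exact ⟨φ, hφ, fun σ hσ x => forall_smul_mem_iff_of_unique_fibre h2 e hφ hφψ huniq hσ x⟩

end Lonely

/-! ## §2 Two sextic fields over non-isomorphic imaginary quadratic fields: `φ₀(K₀) ∩ φ₁(K₁) ⊂ ℝ` -/

section Quadratic

variable {k k' M : Type*} [Field k] [Field k'] [Field M] [Algebra ℚ k] [Algebra ℚ k'] [Algebra ℚ M]

/-- **A field of degree not divisible by `4` has at most one quadratic subfield**: two quadratic `ℚ`-subalgebras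
`j(k)`, `j'(k')` of `M` coincide (their compositum has degree `≤ 4`, `> 2`, even and dividing `[M : ℚ]`), so `k ≅ k'`.
[cite: Lang2002, VI §1 Thm. 1.1 and Cor. 1.6] -/
theorem nonempty_algEquiv_of_finrank_eq_two [FiniteDimensional ℚ M] (h2 : finrank ℚ k = 2)
    (h2' : finrank ℚ k' = 2) (h4 : ¬ 4 ∣ finrank ℚ M) (j : k →ₐ[ℚ] M) (j' : k' →ₐ[ℚ] M) : Nonempty (k ≃ₐ[ℚ] k') := by
  -- pin the `ℚ`-algebra structures of the subfields (Mathlib's `IntermediateField.algebra'`)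
  letI iR : Algebra ℚ ↥j.fieldRange := IntermediateField.algebra' _
  letI iR' : Algebra ℚ ↥j'.fieldRange := IntermediateField.algebra' _
  letI iRR' : Algebra ℚ ↥(j.fieldRange ⊔ j'.fieldRange) := IntermediateField.algebra' _
  haveI : FiniteDimensional ℚ k := Module.finite_of_finrank_pos (by rw [h2]; norm_num)
  haveI : FiniteDimensional ℚ k' := Module.finite_of_finrank_pos (by rw [h2']; norm_num)
  haveI : FiniteDimensional ℚ ↥j.fieldRange := j.toLinearMap.finiteDimensional_range
  haveI : FiniteDimensional ℚ ↥j'.fieldRange := j'.toLinearMap.finiteDimensional_range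
  have hR : finrank ℚ ↥j.fieldRange = 2 :=
    ((AlgEquiv.ofInjectiveField j).toLinearEquiv.finrank_eq).symm.trans h2
  have hR' : finrank ℚ ↥j'.fieldRange = 2 :=
    ((AlgEquiv.ofInjectiveField j').toLinearEquiv.finrank_eq).symm.trans h2'
  -- the two images coincide
  have heq : j.fieldRange = j'.fieldRange := by
    by_contra hne
    have hlt : j.fieldRange < j.fieldRange ⊔ j'.fieldRange := by
      refine lt_of_le_of_ne le_sup_left fun h => hne ?_
      have hle : j'.fieldRange ≤ j.fieldRange := h ▸ le_sup_right
      exact (IntermediateField.eq_of_le_of_finrank_eq hle (hR'.trans hR.symm)).symm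
    have hle4 : finrank ℚ ↥(j.fieldRange ⊔ j'.fieldRange) ≤ 4 := by
      have := IntermediateField.finrank_sup_le j.fieldRange j'.fieldRange
      rw [hR, hR'] at this
      exact this
    have h2dvd : 2 ∣ finrank ℚ ↥(j.fieldRange ⊔ j'.fieldRange) :=
      hR ▸ IntermediateField.finrank_dvd_of_le_right (le_sup_left : j.fieldRange ≤ j.fieldRange ⊔ j'.fieldRange)
    have hne2 : finrank ℚ ↥(j.fieldRange ⊔ j'.fieldRange) ≠ 2 := fun h =>
      hlt.ne (IntermediateField.eq_of_le_of_finrank_eq hlt.le (hR.trans h.symm))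
    have hdvdM : finrank ℚ ↥(j.fieldRange ⊔ j'.fieldRange) ∣ finrank ℚ M := by
      have := IntermediateField.finrank_dvd_of_le_right (le_top : j.fieldRange ⊔ j'.fieldRange ≤ ⊤)
      rwa [IntermediateField.finrank_top'] at this
    have hpos : 0 < finrank ℚ ↥(j.fieldRange ⊔ j'.fieldRange) := Module.finrank_pos
    obtain ⟨m, hm⟩ := h2dvd
    have h4' : finrank ℚ ↥(j.fieldRange ⊔ j'.fieldRange) = 4 := by omega
    exact h4 (h4' ▸ hdvdM)
  have heq' : j.range = j'.range := by
    rw [← AlgHom.fieldRange_toSubalgebra, ← AlgHom.fieldRange_toSubalgebra, heq]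
  exact ⟨(AlgEquiv.ofInjectiveField j).trans
    ((Subalgebra.equivOfEq _ _ heq').trans (AlgEquiv.ofInjectiveField j').symm)⟩

variable {k₀ k₁ K₀ K₁ : Type} [Field k₀] [NumberField k₀] [Field k₁] [NumberField k₁]
  [Field K₀] [NumberField K₀] [IsCMField K₀] [Field K₁] [NumberField K₁] [IsCMField K₁]

/-- The image of a CM field under a complex embedding is stable under complex conjugation. [cite: Shimura1998, §18.1] -/
theorem conj_mem_fieldRange (φ : K₀ →+* ℂ) {z : ℂ} (hz : z ∈ φ.toRatAlgHom.fieldRange) :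
    starRingEnd ℂ z ∈ φ.toRatAlgHom.fieldRange := by
  obtain ⟨a, rfl⟩ := AlgHom.mem_fieldRange.1 hz
  exact AlgHom.mem_fieldRange.2 ⟨IsCMField.complexConj K₀ a, by
    change φ (IsCMField.complexConj K₀ a) = starRingEnd ℂ (φ a)
    exact IsCMField.complexEmbedding_complexConj K₀ φ a⟩

/-- A subfield of `ℂ` of finite degree, stable under complex conjugation and NOT fixed pointwise by it, has EVEN degree
(Artin: the fixed field of the group `{1, c}` has index `2`). [cite: Lang2002, VI §1 Thm. 1.8] -/
theorem even_finrank_of_conj_mem (Q : IntermediateField ℚ ℂ) [FiniteDimensional ℚ Q]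
    (hQ : ∀ z : ℂ, z ∈ Q → starRingEnd ℂ z ∈ Q) {z : ℂ} (hz : z ∈ Q) (hcz : starRingEnd ℂ z ≠ z) :
    2 ∣ finrank ℚ ↥Q := by
  classical
  let c : ↥Q ≃ₐ[ℚ] ↥Q :=
    { toFun := fun x => ⟨starRingEnd ℂ x, hQ x x.2⟩
      invFun := fun x => ⟨starRingEnd ℂ x, hQ x x.2⟩
      left_inv := fun x => Subtype.ext (Complex.conj_conj _)
      right_inv := fun x => Subtype.ext (Complex.conj_conj _)
      map_mul' := fun x y => Subtype.ext (map_mul _ _ _)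
      map_add' := fun x y => Subtype.ext (map_add _ _ _)
      commutes' := fun q => Subtype.ext (by
        change starRingEnd ℂ (algebraMap ℚ ℂ q) = algebraMap ℚ ℂ q
        rw [eq_ratCast, map_ratCast]) }
  have hc : ∀ x : ↥Q, ((c x : ↥Q) : ℂ) = starRingEnd ℂ x := fun _ => rfl
  have hc1 : c ≠ 1 := fun h => hcz (by
    have := congrArg (fun f : ↥Q ≃ₐ[ℚ] ↥Q => ((f ⟨z, hz⟩ : ↥Q) : ℂ)) h
    simpa [hc] using this)
  have hc2 : c ^ 2 = 1 := by
    rw [pow_two]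
    exact AlgEquiv.ext fun x => Subtype.ext (by rw [AlgEquiv.mul_apply, AlgEquiv.one_apply, hc, hc, Complex.conj_conj])
  have hord : orderOf c = 2 := orderOf_eq_prime hc2 hc1
  have hcard : Nat.card (Subgroup.zpowers c) = 2 := by rw [Nat.card_zpowers, hord]
  have hfix : finrank ↥(IntermediateField.fixedField (Subgroup.zpowers c)) ↥Q = 2 := by
    rw [IntermediateField.finrank_fixedField_eq_card, hcard]
  have htower := Module.finrank_mul_finrank ℚ ↥(IntermediateField.fixedField (Subgroup.zpowers c)) ↥Q
  rw [hfix] at htower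
  exact Dvd.intro_left _ htower

/-- **Complex conjugation fixes `φ₀(K₀) ∩ φ₁(K₁)` pointwise** for sextic CM fields `K₀ ⊇ k₀`, `K₁ ⊇ k₁` through
NON-ISOMORPHIC imaginary quadratic fields (`Hom(k₀, k₁) = ∅`) and any complex embeddings `φ₀`, `φ₁`: the
conjugation-stable field `Q = φ₀(K₀) ∩ φ₁(K₁)` has degree dividing `6`; were it not real its degree would be even, so `2` or
`6`, and then one imaginary quadratic field (`Q`, resp. `k₀`) would embed in both `K₀` and `K₁` — but a sextic field has
at most one quadratic subfield. [cite: Shimura1998, §8.4 and §18.1] [cite: Lang2002, VI §1 Thm. 1.8 and Cor. 1.6] -/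
theorem conj_apply_eq_of_mem_fieldRange [IsTotallyComplex k₀] [IsTotallyComplex k₁] (h2₀ : finrank ℚ k₀ = 2)
    (h2₁ : finrank ℚ k₁ = 2) (h6₀ : finrank ℚ K₀ = 6) (h6₁ : finrank ℚ K₁ = 6) (e₀ : k₀ →+* K₀) (e₁ : k₁ →+* K₁)
    (hk : IsEmpty (k₀ →+* k₁)) (φ₀ : K₀ →+* ℂ) (φ₁ : K₁ →+* ℂ) {z : ℂ} (hz₀ : z ∈ φ₀.toRatAlgHom.fieldRange)
    (hz₁ : z ∈ φ₁.toRatAlgHom.fieldRange) : starRingEnd ℂ z = z := by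
  classical
  by_contra hcz
  set E₀ : IntermediateField ℚ ℂ := φ₀.toRatAlgHom.fieldRange with hE₀
  set E₁ : IntermediateField ℚ ℂ := φ₁.toRatAlgHom.fieldRange with hE₁
  -- pin the `ℚ`-algebra structures of the subfields (Mathlib's `IntermediateField.algebra'`)
  letI i₀ : Algebra ℚ ↥E₀ := IntermediateField.algebra' _
  letI i₁ : Algebra ℚ ↥E₁ := IntermediateField.algebra' _
  letI i₀₁ : Algebra ℚ ↥(E₀ ⊓ E₁) := IntermediateField.algebra' _
  have hQ₀ : E₀ ⊓ E₁ ≤ E₀ := inf_le_left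
  have hQ₁ : E₀ ⊓ E₁ ≤ E₁ := inf_le_right
  haveI : FiniteDimensional ℚ ↥E₀ := φ₀.toRatAlgHom.toLinearMap.finiteDimensional_range
  haveI : FiniteDimensional ℚ ↥E₁ := φ₁.toRatAlgHom.toLinearMap.finiteDimensional_range
  haveI : FiniteDimensional ℚ ↥(E₀ ⊓ E₁) :=
    FiniteDimensional.of_injective (IntermediateField.inclusion hQ₀).toLinearMap
      (IntermediateField.inclusion_injective hQ₀)
  have h6E₀ : finrank ℚ ↥E₀ = 6 := ((AlgEquiv.ofInjectiveField φ₀.toRatAlgHom).toLinearEquiv.finrank_eq).symm.trans h6₀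
  have h6E₁ : finrank ℚ ↥E₁ = 6 := ((AlgEquiv.ofInjectiveField φ₁.toRatAlgHom).toLinearEquiv.finrank_eq).symm.trans h6₁
  -- `Q = E₀ ∩ E₁` is conjugation-stable, not fixed pointwise: even degree dividing `6`
  have h2dvd : 2 ∣ finrank ℚ ↥(E₀ ⊓ E₁) :=
    even_finrank_of_conj_mem (E₀ ⊓ E₁) (fun x hx => ⟨conj_mem_fieldRange φ₀ hx.1, conj_mem_fieldRange φ₁ hx.2⟩)
      ⟨hz₀, hz₁⟩ hcz
  have hdvd6 : finrank ℚ ↥(E₀ ⊓ E₁) ∣ 6 := h6E₀ ▸ IntermediateField.finrank_dvd_of_le_right hQ₀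
  have hpos : 0 < finrank ℚ ↥(E₀ ⊓ E₁) := Module.finrank_pos
  have hle6 : finrank ℚ ↥(E₀ ⊓ E₁) ≤ 6 := Nat.le_of_dvd (by norm_num) hdvd6
  -- the embeddings `k₀ → K₀`, `Q → K₀`, `Q → K₁`, `k₁ → K₁` as `ℚ`-algebra maps
  let ι₀ : ↥(E₀ ⊓ E₁) →ₐ[ℚ] K₀ :=
    ((AlgEquiv.ofInjectiveField φ₀.toRatAlgHom).symm.toAlgHom).comp (IntermediateField.inclusion hQ₀)
  let ι₁ : ↥(E₀ ⊓ E₁) →ₐ[ℚ] K₁ :=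
    ((AlgEquiv.ofInjectiveField φ₁.toRatAlgHom).symm.toAlgHom).comp (IntermediateField.inclusion hQ₁)
  have h4₀ : ¬ 4 ∣ finrank ℚ K₀ := by rw [h6₀]; decide
  have h4₁ : ¬ 4 ∣ finrank ℚ K₁ := by rw [h6₁]; decide
  obtain ⟨m, hm⟩ := h2dvd
  have hcases : finrank ℚ ↥(E₀ ⊓ E₁) = 2 ∨ finrank ℚ ↥(E₀ ⊓ E₁) = 6 := by
    interval_cases h : finrank ℚ ↥(E₀ ⊓ E₁) <;> omega
  rcases hcases with hQ2 | hQ6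
  · -- `Q` is quadratic: `k₀ ≅ Q ≅ k₁`
    obtain ⟨f₀⟩ := nonempty_algEquiv_of_finrank_eq_two h2₀ hQ2 h4₀ e₀.toRatAlgHom ι₀
    obtain ⟨f₁⟩ := nonempty_algEquiv_of_finrank_eq_two hQ2 h2₁ h4₁ ι₁ e₁.toRatAlgHom
    exact hk.false (f₀.trans f₁).toRingEquiv.toRingHom
  · -- `Q = E₀`: then `k₀ ↪ K₀ ≅ E₀ = Q ↪ K₁`, and `k₀ ≅ k₁` inside `K₁`
    have hQE₀ : E₀ ⊓ E₁ = E₀ := IntermediateField.eq_of_le_of_finrank_eq hQ₀ (hQ6.trans h6E₀.symm)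
    let g : k₀ →ₐ[ℚ] K₁ :=
      ι₁.comp (((IntermediateField.equivOfEq hQE₀).symm.toAlgHom).comp
        ((AlgEquiv.ofInjectiveField φ₀.toRatAlgHom).toAlgHom.comp e₀.toRatAlgHom))
    obtain ⟨f⟩ := nonempty_algEquiv_of_finrank_eq_two h2₀ h2₁ h4₁ g e₁.toRatAlgHom
    exact hk.false f.toRingEquiv.toRingHom

end Quadratic

end WeilFibre

/-! ## §3 Two sextic fields over non-isomorphic imaginary quadratic fields: types and abelian varieties -/

section Pairs

open CategoryTheory CategoryTheory.Limits
open Literature.AlgebraicGeometry.HodgeTheory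
open Literature.AlgebraicGeometry.ComplexMultiplication (IsCMTypeRealisation)
open Literature.AlgebraicGeometry.VanGeemen1994 (hodgeClassSpan)
open Literature.Barriers.HodgeConjecture (divisorClassesSpan)

variable {I : Type} {K : I → Type} [∀ i, Field (K i)] [∀ i, NumberField (K i)] [∀ i, IsCMField (K i)] [Fintype I]
  [DecidableEq I] [Nonempty I] {Φ : ∀ i, CMType (K i)}
variable {k₀ k₁ : Type} [Field k₀] [NumberField k₀] [IsTotallyComplex k₀] [Field k₁] [NumberField k₁]
  [IsTotallyComplex k₁]

/-- **Sextic CM fields through non-isomorphic imaginary quadratic fields: the pair is nondegenerate iff its members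
are** (`Hg(A₀ × A₁) = Hg(A₀) × Hg(A₁)`).  `K_{i₀} ⊇ k₀`, `K_{i₁} ⊇ k₁` sextic CM, `[k₀:ℚ] = [k₁:ℚ] = 2`, `Hom(k₀, k₁) = ∅`
(e.g. `ℚ(ζ₇)` and `F(√−3)`, or the twins `F(√−m)`, `F(√−m·disc F)` for a non-Galois real cubic `F`); ANY types.
[cite: Gordon1999HodgeAVSurvey, §3 Theorem and 7.5–7.7] [cite: Shimura1998, §8.4] -/
theorem isNondegenerateFamily_iff_forall_of_isEmpty_quadratic_ringHom {i₀ i₁ : I} (h01 : i₀ ≠ i₁)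
    (hI : ∀ j, j = i₀ ∨ j = i₁) (h2₀ : finrank ℚ k₀ = 2) (h2₁ : finrank ℚ k₁ = 2) (h6₀ : finrank ℚ (K i₀) = 6)
    (h6₁ : finrank ℚ (K i₁) = 6) (e₀ : k₀ →+* K i₀) (e₁ : k₁ →+* K i₁) (hk : IsEmpty (k₀ →+* k₁)) :
    CMAlgebra.IsNondegenerateFamily Φ ↔ ∀ i, IsNondegenerate (Φ i) := by
  refine ⟨fun h i => h.isNondegenerate i, fun hnd => ?_⟩
  obtain ⟨φ₀, -, hφ₀⟩ := WeilFibre.exists_mem_forall_smul_eq h2₀ h6₀ e₀ (hnd i₀)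
  obtain ⟨φ₁, -, hφ₁⟩ := WeilFibre.exists_mem_forall_smul_eq h2₁ h6₁ e₁ (hnd i₁)
  haveI : FiniteDimensional ℚ ↥φ₀.toRatAlgHom.fieldRange := φ₀.toRatAlgHom.toLinearMap.finiteDimensional_range
  haveI : FiniteDimensional ℚ ↥φ₁.toRatAlgHom.fieldRange := φ₁.toRatAlgHom.toLinearMap.finiteDimensional_range
  exact (isNondegenerateFamily_iff_forall_of_fixingFields_inf_real h01 hI φ₀.toRatAlgHom.fieldRange
    φ₁.toRatAlgHom.fieldRange (forall_smul_mem_iff_of_forall_apply_fieldRange_eq φ₀ hφ₀)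
    (forall_smul_mem_iff_of_forall_apply_fieldRange_eq φ₁ hφ₁)
    (fun z hz₀ hz₁ => WeilFibre.conj_apply_eq_of_mem_fieldRange h2₀ h2₁ h6₀ h6₁ e₀ e₁ hk φ₀ φ₁ hz₀ hz₁)).2 hnd

variable {A : I → AbelianVariety ℂ} {ι : ∀ i, 𝓞 (K i) →+* End (A i)}
  {θ : ∀ i, K i →+* Module.End ℂ (complexBetti (A i).X 1)}

/-- **The Hodge conjecture on every `A₀^a × A₁^b`** (every `⨁_{j<N} A_{π j}`), with `B• = D•` there, for realisations of
NONDEGENERATE types of sextic CM fields through non-isomorphic imaginary quadratic fields — UNCONDITIONAL.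
[cite: Gordon1999HodgeAVSurvey, §3 Theorem and 10.10] -/
theorem hodgeConjectureFor_prod_of_isEmpty_quadratic_ringHom {i₀ i₁ : I} (h01 : i₀ ≠ i₁)
    (hI : ∀ j, j = i₀ ∨ j = i₁) (h2₀ : finrank ℚ k₀ = 2) (h2₁ : finrank ℚ k₁ = 2) (h6₀ : finrank ℚ (K i₀) = 6)
    (h6₁ : finrank ℚ (K i₁) = 6) (e₀ : k₀ →+* K i₀) (e₁ : k₁ →+* K i₁) (hk : IsEmpty (k₀ →+* k₁))
    (hnd : ∀ i, IsNondegenerate (Φ i)) (hA : ∀ i, IsCMTypeRealisation (Φ i) (A i) (ι i) (θ i)) {N : ℕ}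
    (π : Fin N → I) :
    HodgeConjectureFor (⨁ fun j : Fin N => A (π j)).dim (⨁ fun j : Fin N => A (π j)).X ∧
      ∀ m : ℕ, hodgeClassSpan (⨁ fun j : Fin N => A (π j)).dim (⨁ fun j : Fin N => A (π j)).X m =
        divisorClassesSpan (⨁ fun j : Fin N => A (π j)).X (⨁ fun j : Fin N => A (π j)).dim m :=
  have h := (isNondegenerateFamily_iff_forall_of_isEmpty_quadratic_ringHom h01 hI h2₀ h2₁ h6₀ h6₁ e₀ e₁ hk).2 hnd
  ⟨h.hodgeConjectureFor_prod hA π, fun m => h.hodgeClassSpan_prod_eq_divisorClassesSpan hA π m⟩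

/-- **Two SIMPLE CM abelian threefolds whose sextic CM fields contain non-isomorphic imaginary quadratic fields form a
nondegenerate pair** (`Hg(T₀ × T₁) = Hg(T₀) × Hg(T₁)`; simple sextic types are nondegenerate by Ribet's bound) — the
cases cyclic × dihedral and dihedral × dihedral with `k₀ ≄ k₁` of the census of pairs of simple CM threefolds,
including two threefolds with the twin fields `F(√−m)`, `F(√−m·disc F)`.
[cite: Gordon1999HodgeAVSurvey, §3 Theorem, 7.5–7.7 and Ribet (3.7)] -/
theorem isNondegenerateFamily_sexticThreefolds_of_isEmpty_quadratic_ringHom {i₀ i₁ : I} (h01 : i₀ ≠ i₁)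
    (hI : ∀ j, j = i₀ ∨ j = i₁) (h2₀ : finrank ℚ k₀ = 2) (h2₁ : finrank ℚ k₁ = 2) (h6 : ∀ i, finrank ℚ (K i) = 6)
    (e₀ : k₀ →+* K i₀) (e₁ : k₁ →+* K i₁) (hk : IsEmpty (k₀ →+* k₁))
    (hA : ∀ i, IsCMTypeRealisation (Φ i) (A i) (ι i) (θ i)) (hS : ∀ i, (A i).IsSimple) :
    CMAlgebra.IsNondegenerateFamily Φ :=
  (isNondegenerateFamily_iff_forall_of_isEmpty_quadratic_ringHom h01 hI h2₀ h2₁ (h6 i₀) (h6 i₁) e₀ e₁ hk).2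
    fun i => isNondegenerate_of_isSimple_of_finrank_eq_six (h6 i) (hA i) (hS i)

/-- **The Hodge conjecture and `B• = D•` on every `T₀^a × T₁^b`** (every `⨁_{j<N} T_{π j}`) for two SIMPLE CM abelian
threefolds whose sextic CM fields contain non-isomorphic imaginary quadratic fields — UNCONDITIONALLY; e.g. `ℚ(ζ₇) ×
F(√−3)` (`F` any totally real cubic), `F(√−1) × F(√−disc F)`, `F(√−2) × F′(√−5)`.
[cite: Gordon1999HodgeAVSurvey, §3 Theorem and 10.10] -/
theorem hodgeConjectureFor_prod_sexticThreefolds_of_isEmpty_quadratic_ringHom {i₀ i₁ : I} (h01 : i₀ ≠ i₁)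
    (hI : ∀ j, j = i₀ ∨ j = i₁) (h2₀ : finrank ℚ k₀ = 2) (h2₁ : finrank ℚ k₁ = 2) (h6 : ∀ i, finrank ℚ (K i) = 6)
    (e₀ : k₀ →+* K i₀) (e₁ : k₁ →+* K i₁) (hk : IsEmpty (k₀ →+* k₁))
    (hA : ∀ i, IsCMTypeRealisation (Φ i) (A i) (ι i) (θ i)) (hS : ∀ i, (A i).IsSimple) {N : ℕ} (π : Fin N → I) :
    HodgeConjectureFor (⨁ fun j : Fin N => A (π j)).dim (⨁ fun j : Fin N => A (π j)).X ∧
      ∀ m : ℕ, hodgeClassSpan (⨁ fun j : Fin N => A (π j)).dim (⨁ fun j : Fin N => A (π j)).X m =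
        divisorClassesSpan (⨁ fun j : Fin N => A (π j)).X (⨁ fun j : Fin N => A (π j)).dim m :=
  have h := isNondegenerateFamily_sexticThreefolds_of_isEmpty_quadratic_ringHom h01 hI h2₀ h2₁ h6 e₀ e₁ hk hA hS
  ⟨h.hodgeConjectureFor_prod hA π, fun m => h.hodgeClassSpan_prod_eq_divisorClassesSpan hA π m⟩

/-- **No exceptional Hodge class on any `T₀^a × T₁^b`** for two simple CM threefolds whose sextic CM fields contain
non-isomorphic imaginary quadratic fields. [cite: Gordon1999HodgeAVSurvey, 7.5 and 7.6.1] -/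
theorem not_exists_exceptional_prod_sexticThreefolds_of_isEmpty_quadratic_ringHom {i₀ i₁ : I} (h01 : i₀ ≠ i₁)
    (hI : ∀ j, j = i₀ ∨ j = i₁) (h2₀ : finrank ℚ k₀ = 2) (h2₁ : finrank ℚ k₁ = 2) (h6 : ∀ i, finrank ℚ (K i) = 6)
    (e₀ : k₀ →+* K i₀) (e₁ : k₁ →+* K i₁) (hk : IsEmpty (k₀ →+* k₁))
    (hA : ∀ i, IsCMTypeRealisation (Φ i) (A i) (ι i) (θ i)) (hS : ∀ i, (A i).IsSimple) {N : ℕ} (π : Fin N → I)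
    (m : ℕ) :
    ¬∃ c : complexBetti (⨁ fun j : Fin N => A (π j)).X (2 * m), IsRationalClass c ∧
        IsOfHodgeType (⨁ fun j : Fin N => A (π j)).dim (⨁ fun j : Fin N => A (π j)).X (2 * m) m m c ∧
        c ∉ divisorClassesSpan (⨁ fun j : Fin N => A (π j)).X (⨁ fun j : Fin N => A (π j)).dim m :=
  (isNondegenerateFamily_sexticThreefolds_of_isEmpty_quadratic_ringHom h01 hI h2₀ h2₁ h6 e₀ e₁ hk hA
    hS).not_exists_exceptional_prod hA π m

end Pairs

end Summit.HodgeConjecture.CorCM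

end
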